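import Literature.AlgebraicGeometry.Motives.HodgeLieCommutantEigenspaces
import Literature.Algebra.Lie.NoInvariantFormOfVanishingIntertwiners
import HarnessLib

/-!
# No non-degenerate invariant bilinear form on the eigenspace `W` of an imaginary quadratic `K = End_Hdg(V)`: the eigenspace `W = ker(φ_ℂ - μ)` is not a self-dual `𝔤_ℂ`-module (the WEIL LEG of the (3|3)-square, Hodge-structure level)

Family `hodge`, layer `Literature/AlgebraicGeometry/Motives` (abstract polarizable `ℚ`-Hodge structures; no geometry), namespace
`Literature.AlgebraicGeometry.Motives.HodgeStructure`, grouping sub-namespace `CentralEigen`. THEOREMS ONLY (no definition, no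
named fact, no `sorry`). Written for the cell `pub-hodgeav-hg6` (req-37 (A) Q2b; eng-4 g7, «W5»; lead g2 2026-08-29T00:51:12Z (3):
«… so that W3 applies and the (3|3) owner receives ‹no invariant form› as a one-line citation»). HONEST FRAMING: nothing here
proves HC / HC_AV / HC_CM or the rung H2; unconditional linear algebra of Hodge structures; no step towards a summit statement.

THE STATEMENT (branch 3 of the (3|3)-square's trichotomy is EMPTY for `End_Hdg = K`). Let `H` be a `ℚ`-Hodge structure on a
finite-dimensional `V` with polarization `ψ`, `φ ∈ End_Hdg(V)` with `φ² = -d` (`d > 0`), `φ` commuting with `End_Hdg(V)` and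
`ψ`-skew (both automatic when `End_Hdg(V) = ℚ + ℚφ = K`, by commutativity and by the positivity of the Rosati involution,
the tree's `UnitaryTheta.form_apply_add_form_apply_eq_zero`), `μ² = -d`, `W = ker(φ_ℂ - μ)`, `W̄ = ker(φ_ℂ + μ)`, and `𝔤` an
ADMISSIBLE rational Lie algebra (`Θ ∈ 𝔤_ℂ`, `𝔤` commutes with `End_Hdg`, `𝔤` is `ψ`-skew — e.g. `𝔤 = Lie Hg(H)`). If `W ≠ 0`
there is NO bilinear form `b` on `V_ℂ` which is left-non-degenerate ON `W` and INVARIANT on `W` under the `X_ℂ`, `X ∈ 𝔤`: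
**`CentralEigen.not_exists_invariant_form_on_eigenspace`** (+ `…_of_endAlg_eq` for `End_Hdg = ℚ + ℚφ`, `…_hodgeLie` for
`𝔤 = Lie Hg`). PROOF = the tree's abstract half W3 (`Literature.Algebra.Lie.no_nondegenerate_invariant_form_of_forall_intertwiner_eq_zero`,
Fulton–Harris Lemma 3.35: a non-degenerate invariant form is an equivariant `W ≅ W^*`) with
* the equivariant duality `θ : W̄ ≃ W^*`, `w̄ ↦ ψ_ℂ(w̄, ·)|_W` — injective because `W̄` is `ψ_ℂ`-isotropic
  (`UnitaryTheta.form_eq_zero_of_mem_eigenspace`), `V_ℂ = W + W̄` (`UnitaryTheta.exists_eigen_add_eigen`) and `ψ_ℂ` is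
  non-degenerate; bijective by the symmetric dimension count; equivariant for the contragredient action because `𝔤` is `ψ`-skew
  (`CentralEigen.exists_dualityEquiv`);
* `Hom_𝔤(W, W̄) = 0` (`CentralEigen.linearMap_eigenspace_eq_zero`, `Motives/HodgeLieCommutantEigenspaces`: Moonen–Zarhin 1999,
  proof of Lemma (3.4), «`U_1, …, U_e` pairwise non-isomorphic»).
In print this is the remark that for `End⁰(X) = K` of Weil type the two summands `W`, `W̄` of `V ⊗ ℂ` are non-isomorphic,
mutually dual (`W̄ ≅ W^*` via `ψ`), irreducible `hg_ℂ`-modules (Moonen–Zarhin 1999 §3, proof of (3.4); Moonen–Zarhin 1998 §1,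
`Hg ⊆ U_K`, `SU` for the special members), so `W` carries no `hg`-invariant form. For the SPECIAL Weil members of TABLE X rows
9 / 13 (`Hg ⊊ SU_K`, `End⁰ = K`) this kills the branch «`W` self-dual as a `[𝔊,𝔊]`-module» once `[𝔊,𝔊] = 𝔊`
(`HodgeTheory.IsWeilType.hodgeLie_eq_derived_of_centre_le`, W2) — assembled on the abelian-variety side in the companion file.
NOT here: irreducibility of `W` (tree: `UnitaryTheta.eq_bot_or_eq_of_stable`), tracelessness, anything about abelian varieties.

## References

* [FultonHarris1991] W. Fulton, J. Harris, *Representation Theory*, GTM 129, §3.5 Lemma 3.35.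
* [MoonenZarhin1999LowDim] B. Moonen, Yu. Zarhin, Math. Ann. 315 (1999) = arXiv:math/9901113, §3 proof of Lemma (3.4).
* [MoonenZarhin1998WeilClasses] B. Moonen, Yu. Zarhin, *Weil classes on abelian varieties*, Crelle 496 (1998), §1.
* [Gordon1997] B. B. Gordon, arXiv:alg-geom/9709030, §6 (proof of Thm. 6.3.3, p. 19: `W′`, `W″` in perfect duality under `ψ`).
* [Deligne1982HodgeCycles] P. Deligne, LNM 900 (1982), I §3 Prop. 3.4, §4 p. 30.
-/

noncomputable section

open scoped TensorProduct

namespace Literature.AlgebraicGeometry.Motives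

namespace HodgeStructure

universe u

variable {V : Type u} [AddCommGroup V] [Module ℚ V] [Module.Finite ℚ V] {n : ℤ}

/-! ### §1 The equivariant duality `θ : W̄ ≃ W^*` from the polarization -/

omit [Module.Finite ℚ V] in
/-- Injectivity of the `ψ_ℂ`-pairing `U′ → U^*` when `U′` is isotropic and `V_ℂ = U + U′`: a vector of `U′` orthogonal to `U` is
orthogonal to everything, hence `0`. [cite: Gordon1997, §6 (proof of Thm. 6.3.3, p. 19)] -/
private theorem CentralEigen.eq_zero_of_forall_form_eq_zero_of_isotropic {H : HodgeStructure V n} (ψ : H.Polarization)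
    {U U' : Submodule ℂ (ℂ ⊗[ℚ] V)} (hiso : ∀ x ∈ U', ∀ y ∈ U', ψ.form.baseChange ℂ x y = 0)
    (hsum : ∀ v : ℂ ⊗[ℚ] V, ∃ w ∈ U, ∃ w' ∈ U', v = w + w') {x : ℂ ⊗[ℚ] V} (hx : x ∈ U')
    (horth : ∀ w ∈ U, ψ.form.baseChange ℂ x w = 0) : x = 0 := by
  refine ψ.eq_zero_of_forall_form_eq_zero fun v => ?_
  obtain ⟨w, hw, w', hw', rfl⟩ := hsum v
  rw [map_add, horth w hw, hiso x hx w' hw', add_zero]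

/-- **The equivariant duality `θ : W̄ ≃ W^*`, `θ(w̄)(w) = ψ_ℂ(w̄, w)`.** For `φ ∈ End(V)` with `φ² = -d`, `d > 0`, `ψ`-skew, and
`μ² = -d`: `W = ker(φ_ℂ - μ)` and `W̄ = ker(φ_ℂ + μ)` are `ψ_ℂ`-isotropic with `V_ℂ = W ⊕ W̄`, so `ψ_ℂ` puts them in perfect
duality (Gordon §6: «the symplectic form … induces a duality between `W′` and `W″`»); for every `ψ`-skew `X` the duality is
equivariant for the contragredient action: `θ(X_ℂ w̄) = -θ(w̄) ∘ X_ℂ|_W`. [cite: Gordon1997, §6 (proof of Thm. 6.3.3, p. 19)]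
[cite: MoonenZarhin1999LowDim, §2 (2.3)] -/
theorem CentralEigen.exists_dualityEquiv {H : HodgeStructure V n} (ψ : H.Polarization) {φ : Module.End ℚ V} {d : ℚ}
    (hd : 0 < d) (hφ2 : φ * φ = -(d • 1)) (hφskew : ∀ v w, ψ.form (φ v) w + ψ.form v (φ w) = 0) {μ : ℂ}
    (hμ : μ ^ 2 = -(d : ℂ)) :
    ∃ θ : Module.End.eigenspace (φ.baseChange ℂ) (-μ) ≃ₗ[ℂ] Module.Dual ℂ (Module.End.eigenspace (φ.baseChange ℂ) μ),
      (∀ (w' : Module.End.eigenspace (φ.baseChange ℂ) (-μ)) (w : Module.End.eigenspace (φ.baseChange ℂ) μ),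
          θ w' w = ψ.form.baseChange ℂ (w' : ℂ ⊗[ℚ] V) (w : ℂ ⊗[ℚ] V)) ∧
        ∀ (X : Module.End ℚ V) (hXφ : X * φ = φ * X), (∀ v w, ψ.form (X v) w + ψ.form v (X w) = 0) →
          ∀ w' : Module.End.eigenspace (φ.baseChange ℂ) (-μ),
            θ ((X.baseChange ℂ).restrict (fun x hx => UnitaryTheta.apply_mem_eigenspace_of_commute
                (by rw [← LinearMap.baseChange_mul, hXφ, LinearMap.baseChange_mul]) hx) w') =
              -((θ w').comp ((X.baseChange ℂ).restrict (fun x hx => UnitaryTheta.apply_mem_eigenspace_of_commute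
                (by rw [← LinearMap.baseChange_mul, hXφ, LinearMap.baseChange_mul]) hx))) := by
  set W := Module.End.eigenspace (φ.baseChange ℂ) μ with hWdef
  set W' := Module.End.eigenspace (φ.baseChange ℂ) (-μ) with hW'def
  set ψC := ψ.form.baseChange ℂ with hψC
  obtain ⟨hμ0, -⟩ := UnitaryTheta.conj_eq_neg_of_sq hd hμ
  have hφskewC : ∀ x y, ψC (φ.baseChange ℂ x) y + ψC x (φ.baseChange ℂ y) = 0 :=
    ThetaSubalgebra.formBaseChange_add_eq_zero_of_skew ψ hφskew
  have hisoW : ∀ x ∈ W, ∀ y ∈ W, ψC x y = 0 := fun x hx y hy =>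
    UnitaryTheta.form_eq_zero_of_mem_eigenspace hφskewC hμ0 hx hy
  have hisoW' : ∀ x ∈ W', ∀ y ∈ W', ψC x y = 0 := fun x hx y hy =>
    UnitaryTheta.form_eq_zero_of_mem_eigenspace hφskewC (neg_ne_zero.2 hμ0) hx hy
  have hsum : ∀ v : ℂ ⊗[ℚ] V, ∃ w ∈ W, ∃ w' ∈ W', v = w + w' := UnitaryTheta.exists_eigen_add_eigen hφ2 hμ hμ0
  have hsum' : ∀ v : ℂ ⊗[ℚ] V, ∃ w' ∈ W', ∃ w ∈ W, v = w' + w := fun v => by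
    obtain ⟨w, hw, w', hw', rfl⟩ := hsum v
    exact ⟨w', hw', w, hw, add_comm _ _⟩
  -- the pairing maps `W' → W^*` and `W → W'^*`, both injective
  set θ₀ : W' →ₗ[ℂ] Module.Dual ℂ W := W.subtype.dualMap ∘ₗ ψC ∘ₗ W'.subtype with hθ₀
  have hθ₀_apply : ∀ (w' : W') (w : W), θ₀ w' w = ψC (w' : ℂ ⊗[ℚ] V) (w : ℂ ⊗[ℚ] V) := fun w' w => rfl
  set θ₁ : W →ₗ[ℂ] Module.Dual ℂ W' := W'.subtype.dualMap ∘ₗ ψC ∘ₗ W.subtype with hθ₁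
  have hθ₁_apply : ∀ (w : W) (w' : W'), θ₁ w w' = ψC (w : ℂ ⊗[ℚ] V) (w' : ℂ ⊗[ℚ] V) := fun w w' => rfl
  have hinj₀ : Function.Injective θ₀ := by
    rw [← LinearMap.ker_eq_bot, Submodule.eq_bot_iff]
    intro w' hw'
    rw [LinearMap.mem_ker] at hw'
    exact Subtype.ext (CentralEigen.eq_zero_of_forall_form_eq_zero_of_isotropic ψ hisoW' hsum w'.2 fun w hw => by
      have h := LinearMap.congr_fun hw' ⟨w, hw⟩
      rwa [hθ₀_apply, LinearMap.zero_apply] at h)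
  have hinj₁ : Function.Injective θ₁ := by
    rw [← LinearMap.ker_eq_bot, Submodule.eq_bot_iff]
    intro w hw
    rw [LinearMap.mem_ker] at hw
    exact Subtype.ext (CentralEigen.eq_zero_of_forall_form_eq_zero_of_isotropic ψ hisoW hsum' w.2 fun w' hw' => by
      have h := LinearMap.congr_fun hw ⟨w', hw'⟩
      rwa [hθ₁_apply, LinearMap.zero_apply] at h)
  -- dimension count: `dim W' = dim W^*`
  have hle₀ : Module.finrank ℂ W' ≤ Module.finrank ℂ W :=
    (LinearMap.finrank_le_finrank_of_injective hinj₀).trans (Subspace.dual_finrank_eq (K := ℂ) (V := W)).le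
  have hle₁ : Module.finrank ℂ W ≤ Module.finrank ℂ W' :=
    (LinearMap.finrank_le_finrank_of_injective hinj₁).trans (Subspace.dual_finrank_eq (K := ℂ) (V := W')).le
  have hdim : Module.finrank ℂ W' = Module.finrank ℂ (Module.Dual ℂ W) := by
    rw [Subspace.dual_finrank_eq]; exact le_antisymm hle₀ hle₁
  have hbij : Function.Bijective θ₀ :=
    ⟨hinj₀, (LinearMap.injective_iff_surjective_of_finrank_eq_finrank hdim).1 hinj₀⟩
  refine ⟨LinearEquiv.ofBijective θ₀ hbij, fun w' w => rfl, fun X hXφ hXskew w' => ?_⟩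
  have hXskewC : ∀ x y, ψC (X.baseChange ℂ x) y + ψC x (X.baseChange ℂ y) = 0 :=
    ThetaSubalgebra.formBaseChange_add_eq_zero_of_skew ψ hXskew
  refine LinearMap.ext fun w => ?_
  change ψC ((X.baseChange ℂ) (w' : ℂ ⊗[ℚ] V)) (w : ℂ ⊗[ℚ] V) = -(ψC (w' : ℂ ⊗[ℚ] V) ((X.baseChange ℂ) (w : ℂ ⊗[ℚ] V)))
  exact eq_neg_of_add_eq_zero_left (hXskewC _ _)

/-! ### §2 No invariant non-degenerate form on `W` -/

/-- **No non-degenerate `𝔤`-invariant bilinear form on `W = ker(φ_ℂ - μ)` — the WEIL LEG of the (3|3)-square, Hodge-structure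
level.** `φ ∈ End_Hdg(V)` commuting with `End_Hdg(V)` and `ψ`-skew, `φ² = -d`, `d > 0`, `μ² = -d`; `𝔤` admissible (`Θ ∈ 𝔤_ℂ`,
`𝔤` commutes with `End_Hdg`, `𝔤` is `ψ`-skew); `W ≠ 0`. Then no bilinear form `b` on `V_ℂ` is at once left-non-degenerate ON `W`
and invariant ON `W` under the `X_ℂ`, `X ∈ 𝔤`: such a `b` would be an equivariant `W ≅ W^* ≅ W̄` (Fulton–Harris 3.35 = W3), but
`Hom_𝔤(W, W̄) = 0` (`CentralEigen.linearMap_eigenspace_eq_zero`; Moonen–Zarhin: `W`, `W̄` are non-isomorphic `hg_ℂ`-modules).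
[cite: FultonHarris1991, §3.5 Lemma 3.35] [cite: MoonenZarhin1999LowDim, §3 proof of Lemma (3.4)] [cite: Gordon1997, §6 (proof of Thm. 6.3.3, p. 19)] -/
theorem CentralEigen.not_exists_invariant_form_on_eigenspace (H : HodgeStructure V n) (ψ : H.Polarization)
    {φ : Module.End ℚ V} (hφE : φ ∈ H.endAlg) (hφ : ∀ a ∈ H.endAlg, a * φ = φ * a)
    (hφskew : ∀ v w, ψ.form (φ v) w + ψ.form v (φ w) = 0) {d : ℚ} (hd : 0 < d) (hφ2 : φ * φ = -(d • 1))
    {μ : ℂ} (hμ : μ ^ 2 = -(d : ℂ)) (𝔤 : Submodule ℚ (Module.End ℚ V)) {Θ : Module.End ℂ (ℂ ⊗[ℚ] V)}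
    (hΘ : ∀ p, ∀ x ∈ H.piece p (n - p), Θ x = ((2 * p - n : ℤ) : ℂ) • x) (hΘ𝔤 : Θ ∈ spanC 𝔤)
    (hcomm : ∀ X ∈ 𝔤, ∀ a : H.endAlg, X * (a : Module.End ℚ V) = (a : Module.End ℚ V) * X)
    (hskew : ∀ X ∈ 𝔤, ∀ v w, ψ.form (X v) w + ψ.form v (X w) = 0)
    (hW : Module.End.eigenspace (φ.baseChange ℂ) μ ≠ ⊥) :
    ¬ ∃ b : LinearMap.BilinForm ℂ (ℂ ⊗[ℚ] V),
        (∀ w ∈ Module.End.eigenspace (φ.baseChange ℂ) μ, w ≠ 0 →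
            ∃ w₂ ∈ Module.End.eigenspace (φ.baseChange ℂ) μ, b w w₂ ≠ 0) ∧
          ∀ X ∈ 𝔤, ∀ w ∈ Module.End.eigenspace (φ.baseChange ℂ) μ, ∀ w₂ ∈ Module.End.eigenspace (φ.baseChange ℂ) μ,
            b (X.baseChange ℂ w) w₂ + b w (X.baseChange ℂ w₂) = 0 := by
  set W := Module.End.eigenspace (φ.baseChange ℂ) μ with hWdef
  set W' := Module.End.eigenspace (φ.baseChange ℂ) (-μ) with hW'def
  haveI : Nontrivial W := Submodule.nontrivial_iff_ne_bot.2 hW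
  have hXφ : ∀ X ∈ 𝔤, X * φ = φ * X := fun X hX => hcomm X hX ⟨φ, hφE⟩
  have hXφC : ∀ X ∈ 𝔤, X.baseChange ℂ * φ.baseChange ℂ = φ.baseChange ℂ * X.baseChange ℂ := fun X hX =>
    UnitaryTheta.baseChange_commute H hφE hcomm hX
  have hXW : ∀ X : 𝔤, ∀ x ∈ W, (X : Module.End ℚ V).baseChange ℂ x ∈ W := fun X x hx =>
    UnitaryTheta.apply_mem_eigenspace_of_commute (hXφC X X.2) hx
  have hXW' : ∀ X : 𝔤, ∀ x ∈ W', (X : Module.End ℚ V).baseChange ℂ x ∈ W' := fun X x hx =>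
    UnitaryTheta.apply_mem_eigenspace_of_commute (hXφC X X.2) hx
  -- the restricted actions
  set ρ : 𝔤 → Module.End ℂ W := fun X => ((X : Module.End ℚ V).baseChange ℂ).restrict (hXW X) with hρ
  set ρ' : 𝔤 → Module.End ℂ W' := fun X => ((X : Module.End ℚ V).baseChange ℂ).restrict (hXW' X) with hρ'
  -- the equivariant duality
  obtain ⟨θ, hθapply, hθeq⟩ := CentralEigen.exists_dualityEquiv ψ hd hφ2 hφskew hμ
  have hθ : ∀ (X : 𝔤) (w' : W'), θ (ρ' X w') = -((θ w').comp (ρ X)) := fun X w' =>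
    hθeq (X : Module.End ℚ V) (hXφ X X.2) (hskew X X.2) w'
  -- `Hom_𝔤(W, W̄) = 0`
  have hHom : ∀ f : W →ₗ[ℂ] W', (∀ (X : 𝔤) (w : W), f (ρ X w) = ρ' X (f w)) → f = 0 := by
    intro f hf
    refine CentralEigen.linearMap_eigenspace_eq_zero H hφE hφ hd hφ2 hμ 𝔤 hΘ hΘ𝔤 hcomm f fun X hX w w₁ hw₁ => ?_
    have hw₁' : w₁ = ρ ⟨X, hX⟩ w := Subtype.ext (by rw [hw₁, hρ, LinearMap.coe_restrict_apply])
    rw [hw₁', hf ⟨X, hX⟩ w, hρ', LinearMap.coe_restrict_apply]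
  rintro ⟨b, hnd, hinv⟩
  refine Literature.Algebra.Lie.no_nondegenerate_invariant_form_of_forall_intertwiner_eq_zero ρ ρ' θ hθ hHom
    ⟨b.compl₁₂ W.subtype W.subtype, fun w hw => ?_, fun X w w₂ => ?_⟩
  · obtain ⟨w₂, hw₂, h⟩ := hnd w w.2 fun h => hw (Subtype.ext h)
    exact ⟨⟨w₂, hw₂⟩, by rwa [LinearMap.compl₁₂_apply, Submodule.subtype_apply, Submodule.subtype_apply]⟩
  · rw [LinearMap.compl₁₂_apply, LinearMap.compl₁₂_apply, Submodule.subtype_apply, Submodule.subtype_apply,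
      Submodule.subtype_apply, Submodule.subtype_apply, hρ, LinearMap.coe_restrict_apply, LinearMap.coe_restrict_apply]
    exact hinv X X.2 w w.2 w₂ w₂.2

/-- **No non-degenerate `𝔤`-invariant form on `W` for `End_Hdg(V) = ℚ + ℚφ`** (`= K`, the setting of the cell's unitary files;
`V ≠ 0`): centrality of `φ` by commutativity, `ψ`-skewness of `φ` by the positivity of the Rosati involution
(`UnitaryTheta.form_apply_add_form_apply_eq_zero`). [cite: MoonenZarhin1999LowDim, §2 (2.3) and §3 proof of Lemma (3.4)]
[cite: FultonHarris1991, §3.5 Lemma 3.35] -/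
theorem CentralEigen.not_exists_invariant_form_on_eigenspace_of_endAlg_eq [Nontrivial V] (H : HodgeStructure V n)
    (ψ : H.Polarization) {φ : Module.End ℚ V} (hφE : φ ∈ H.endAlg) {d : ℚ} (hd : 0 < d) (hφ2 : φ * φ = -(d • 1))
    (hE : ∀ a ∈ H.endAlg, ∃ x y : ℚ, a = x • 1 + y • φ) {μ : ℂ} (hμ : μ ^ 2 = -(d : ℂ))
    (𝔤 : Submodule ℚ (Module.End ℚ V)) {Θ : Module.End ℂ (ℂ ⊗[ℚ] V)}
    (hΘ : ∀ p, ∀ x ∈ H.piece p (n - p), Θ x = ((2 * p - n : ℤ) : ℂ) • x) (hΘ𝔤 : Θ ∈ spanC 𝔤)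
    (hcomm : ∀ X ∈ 𝔤, ∀ a : H.endAlg, X * (a : Module.End ℚ V) = (a : Module.End ℚ V) * X)
    (hskew : ∀ X ∈ 𝔤, ∀ v w, ψ.form (X v) w + ψ.form v (X w) = 0)
    (hW : Module.End.eigenspace (φ.baseChange ℂ) μ ≠ ⊥) :
    ¬ ∃ b : LinearMap.BilinForm ℂ (ℂ ⊗[ℚ] V),
        (∀ w ∈ Module.End.eigenspace (φ.baseChange ℂ) μ, w ≠ 0 →
            ∃ w₂ ∈ Module.End.eigenspace (φ.baseChange ℂ) μ, b w w₂ ≠ 0) ∧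
          ∀ X ∈ 𝔤, ∀ w ∈ Module.End.eigenspace (φ.baseChange ℂ) μ, ∀ w₂ ∈ Module.End.eigenspace (φ.baseChange ℂ) μ,
            b (X.baseChange ℂ w) w₂ + b w (X.baseChange ℂ w₂) = 0 := by
  refine CentralEigen.not_exists_invariant_form_on_eigenspace H ψ hφE (fun a ha => ?_)
    (UnitaryTheta.form_apply_add_form_apply_eq_zero H ψ hφE hd hφ2 hE) hd hφ2 hμ 𝔤 hΘ hΘ𝔤 hcomm hskew hW
  obtain ⟨x, y, rfl⟩ := hE a ha
  rw [add_mul, mul_add, smul_mul_assoc, mul_smul_comm, one_mul, mul_one, smul_mul_assoc, mul_smul_comm]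

variable [HodgeTensorFacts.{u, u}]

/-- **No non-degenerate `Lie Hg`-invariant bilinear form on `W`** (`𝔤 = Lie Hg(H)`: bracket-closed, `Θ ∈ (Lie Hg)_ℂ` by
`exists_hodgeTheta` / `mem_hodgeLieC_of_forall_piece`, commuting with `End_Hdg` by `commute_of_mem_hodgeLie`, `ψ`-skew by
`form_apply_add_eq_zero_of_mem_hodgeLie`), for `φ ∈ End_Hdg(V)` central, `ψ`-skew, `φ² = -d`, `W ≠ 0`. For the special
Weil members (`Lie Hg = [Lie Hg, Lie Hg]`, `HodgeTheory.IsWeilType.hodgeLie_eq_derived_of_centre_le`) this is «no non-degenerate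
`[𝔊,𝔊]`-invariant form on `W`». [cite: FultonHarris1991, §3.5 Lemma 3.35] [cite: MoonenZarhin1999LowDim, §3 proof of Lemma (3.4)]
[cite: Zarhin1983HodgeGroupsK3, §2] -/
theorem CentralEigen.not_exists_invariant_form_on_eigenspace_hodgeLie (H : HodgeStructure V n) (ψ : H.Polarization)
    {φ : Module.End ℚ V} (hφE : φ ∈ H.endAlg) (hφ : ∀ a ∈ H.endAlg, a * φ = φ * a)
    (hφskew : ∀ v w, ψ.form (φ v) w + ψ.form v (φ w) = 0) {d : ℚ} (hd : 0 < d) (hφ2 : φ * φ = -(d • 1))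
    {μ : ℂ} (hμ : μ ^ 2 = -(d : ℂ)) (hW : Module.End.eigenspace (φ.baseChange ℂ) μ ≠ ⊥) :
    ¬ ∃ b : LinearMap.BilinForm ℂ (ℂ ⊗[ℚ] V),
        (∀ w ∈ Module.End.eigenspace (φ.baseChange ℂ) μ, w ≠ 0 →
            ∃ w₂ ∈ Module.End.eigenspace (φ.baseChange ℂ) μ, b w w₂ ≠ 0) ∧
          ∀ X ∈ H.hodgeLie, ∀ w ∈ Module.End.eigenspace (φ.baseChange ℂ) μ,
            ∀ w₂ ∈ Module.End.eigenspace (φ.baseChange ℂ) μ, b (X.baseChange ℂ w) w₂ + b w (X.baseChange ℂ w₂) = 0 := by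
  obtain ⟨Θ, hΘ⟩ := exists_hodgeTheta H
  have hΘ𝔤 : Θ ∈ spanC H.hodgeLie := (hodgeLieC_eq_spanC H) ▸ H.mem_hodgeLieC_of_forall_piece hΘ
  exact CentralEigen.not_exists_invariant_form_on_eigenspace H ψ hφE hφ hφskew hd hφ2 hμ H.hodgeLie hΘ hΘ𝔤
    (fun X hX a => H.commute_of_mem_hodgeLie hX a) (fun X hX => form_apply_add_eq_zero_of_mem_hodgeLie ψ hX) hW

end HodgeStructure

end Literature.AlgebraicGeometry.Motives

end
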